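import Summits.AtomisticToContinuum.Crystallization.Theorems.FrustratedLawDichotomyStrainedPatchRimFold

/-!
# Strained patch — THE ROW-PRICED DESCENT (R1⁗): per-row price TABLES absorbed into the slack column, in place of the uniform step targets `k i · σ₁`
# (decomp-a2c lens-5 «finite/base range + asymptotic regime + bridge», generation 75; crux `AperiodicFrustratedLawGap`, stmt-AtomisticToContinuum-27623;
# critic row 1253: «RowPrice ENDORSED TO TYPE as the in-leaf (α) instrument of record», conditions (R1)–(R5))

T-side record: `[CORE-FAR] CoreOffTubeFloor (63/10) (63/10) (24/5) (1/100) 0 ⟸ TubeFloor 𝓘 τ ∧ FamilyCover 𝓘 (24/5) (1/100) (1/8) τ`.  New module on top of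
the landed `…StrainedPatchRimFold` (p852128); zero edits to landed declarations (R1: the table enters the column additively, `SlackCert` / `InForcePolytope` /
`PricedCharge` reused verbatim); no `sorry`; standard axioms.

WHY (census FINAL rev 2 of ASK-73 / SLACK-36, critic rows 1230/1247/1253).  g71's priced descent and its rim-folded form R1‴ lower ONE number per stage:
the price of every inner reach row must drop below the uniform target `k (i+1) · σ₁`, and the terminal certificate is the census LP at the uniform slack
`(1 + k n) σ₁ + X`.  At `τ = 1/100` the LP tolerates a uniform `k n ≲ 0.82` (HZ00) while the price of the rows near the row radius stays `≈ 12 σ₁`; only the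
CORE rows — where the certificate's dual multipliers concentrate — are cheap (`≈ 1.4 σ₁`).  Here the target of stage `i+1` is a PER-ROW TABLE
`P (i+1) : SlackTab` and the whole slack lives in the column: the stage-`i` polytope is `InForcePolytope 0 σ₁ hessBlk0 force0 (addCol X (P i))`, the terminal
certificate `SlackCert 𝓘 τ 0 σ₁ hessBlk0 force0 (addCol X (P n))` — the census LP with row slack `σ₁ + X(h) + P n (h)` (its value is read off the existing
certificate's fixed duals, census-side evidence only (R4); memo NODE-g75 §3).
* §1 COLUMN ARITHMETIC: `addCol`, `constCol`, `rimTab`; the `κ`-polytope IS the `κ = 0` polytope with column `X + κσ` (`inForcePolytope_zero_addCol_iff`,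
  `slackCert_zero_addCol_iff`); the folded polytope IS the `κ = 0` polytope with column `X + rimTab R (κσ) Q` (`inForcePolytope_rim_iff`, `slackCert_rim_iff`).
* §2 `PriceTopTab 𝓘 τ Φ P`, `PriceStepTab 𝓘 τ σ Φ H F Y P` [INSTRUMENTABLE — one constrained sup PER ROW per host cell] and ★★★ `tubeFloor_of_pricedCharge_of_tabDescent`
  [folklore: induction over the tree's `forceCapOne` + `norm_lin_le_of_cap_of_rem`]; (R2) g71's uniform descent and g74's folded descent RE-DERIVED as the
  constant / rim-table instances (`tubeFloor_of_descent_via_tab`, `tubeFloor_of_foldedDescent_via_tab`).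
* §3 (R3) HOST FORMATS `HostTopTab 𝓘 τ B T r P` (per-row START table) and `HostStepTab 𝓘 τ σ B T r H F Y P` (per host cell: linear rows `‖hostLin‖ ≤ σ + Y(h)` at
  the SURE-reach rows ⟹ host quadratic price of MAYBE-reach row `h` is `≤ P(h)`) with soundness `priceTopTab_of_hostTopTab` / `priceStepTab_of_hostStepTab` and
  the instances `hostTopTab_of_hostTop`, `hostStepTab_of_hostStep`, `hostTopTab_rim`, `hostStepTab_rim`, `hostStepTab_of_hostTopTab` (the START table is a valid
  step table at every stage: rows without a sharp price keep their box top — (R5)).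
* §4 RECORDS `coreOff_of_tabDescent`, `coreOff_of_hostTabs`, ★★★ `coreOff_of_envelope_tailCert_tab` = R1⁗ (cover, `2τ < s₀`, host separation, `r + 2τ ≤ 7`,
  (HFAR), (TAILCERT), a dominating column, the per-row host START table `P 0`, a finite table of per-row host steps, the terminal certificate on
  `addCol X (P n)`), its γ-table variant, and (R2) the recovery of R1‴ `coreOff_of_envelope_tailCert_fold_via_tab`.
-/

namespace Summit.AtomisticToContinuum.Crystallization.Theorems.FrustratedLawDichotomyStrainedPatchRowPrice

open scoped BigOperators Classical RealInnerProductSpace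
open Summit.AtomisticToContinuum.Crystallization.Theorems.FrustratedLawDichotomyMotifLemmas
open Summit.AtomisticToContinuum.Crystallization.Theorems.FrustratedLawDichotomyRangeCut
open Summit.AtomisticToContinuum.Crystallization.Theorems.FrustratedLawDichotomyAveragingCut
open Summit.AtomisticToContinuum.Crystallization.Theorems.FrustratedLawDichotomyStrainedPatchHomSplit
open Summit.AtomisticToContinuum.Crystallization.Theorems.FrustratedLawDichotomyStrainedPatchCleanCollar
open Summit.AtomisticToContinuum.Crystallization.Theorems.FrustratedLawDichotomyStrainedPatchPhaseCut
open Summit.AtomisticToContinuum.Crystallization.Theorems.FrustratedLawDichotomyStrainedPatchCoreTube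
open Summit.AtomisticToContinuum.Crystallization.Theorems.FrustratedLawDichotomyStrainedPatchStrainBands
open Summit.AtomisticToContinuum.Crystallization.Theorems.FrustratedLawDichotomyStrainedPatchHomIsometry
open Summit.AtomisticToContinuum.Crystallization.Theorems.FrustratedLawDichotomyStrainedPatchHomTubeIso
open Summit.AtomisticToContinuum.Crystallization.Theorems.FrustratedLawDichotomyStrainedPatchEnvelopeLaw
open Summit.AtomisticToContinuum.Crystallization.Theorems.FrustratedLawDichotomyStrainedPatchEnvelopeTaylor
open Summit.AtomisticToContinuum.Crystallization.Theorems.FrustratedLawDichotomyStrainedPatchChartFamilies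
open Summit.AtomisticToContinuum.Crystallization.Theorems.FrustratedLawDichotomyStrainedPatchChartFamiliesPinned
open Summit.AtomisticToContinuum.Crystallization.Theorems.FrustratedLawDichotomyStrainedPatchQuantSlaving
open Summit.AtomisticToContinuum.Crystallization.Theorems.FrustratedLawDichotomyStrainedPatchHostCells
open Summit.AtomisticToContinuum.Crystallization.Theorems.FrustratedLawDichotomyStrainedPatchForceCap
open Summit.AtomisticToContinuum.Crystallization.Theorems.FrustratedLawDichotomyStrainedPatchTextureFloor
open Summit.AtomisticToContinuum.Crystallization.Theorems.FrustratedLawDichotomyStrainedPatchSVCharge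
open Summit.AtomisticToContinuum.Crystallization.Theorems.FrustratedLawDichotomyStrainedPatchChargePrice
open Summit.AtomisticToContinuum.Crystallization.Theorems.FrustratedLawDichotomyStrainedPatchTaylorTop
open Summit.AtomisticToContinuum.Crystallization.Theorems.FrustratedLawDichotomyStrainedPatchTaylorCharge
open Summit.AtomisticToContinuum.Crystallization.Theorems.FrustratedLawDichotomyStrainedPatchHostStep
open Summit.AtomisticToContinuum.Crystallization.Theorems.FrustratedLawDichotomyStrainedPatchBondCalculus
open Summit.AtomisticToContinuum.Crystallization.Theorems.FrustratedLawDichotomyStrainedPatchFarSplit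
open Summit.AtomisticToContinuum.Crystallization.Theorems.FrustratedLawDichotomyStrainedPatchTailPacking
open Summit.AtomisticToContinuum.Crystallization.Theorems.FrustratedLawDichotomyStrainedPatchRimFold

/-! ## §1. Column arithmetic: sums of slack columns, the constant column, the rim table; the `κ`-polytope and the folded polytope as `κ = 0` polytopes -/

/-- **THE SUM OF TWO SLACK COLUMNS** (a per-row price table `P` absorbed into the column `X`). -/
def addCol (X P : SlackTab) : SlackTab := fun M₀ z₀ c₀ h => X M₀ z₀ c₀ h + P M₀ z₀ c₀ h

/-- **THE CONSTANT COLUMN** `≡ ρ` (a uniform step target read as a row table). -/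
def constCol (ρ : ℝ) : SlackTab := fun _ _ _ _ => ρ

/-- **THE RIM TABLE** at host radius `R`: `ρ` at rows within `R` of the centre, `ρ + Q` beyond (g74's fold read as a row table). -/
noncomputable def rimTab (R ρ : ℝ) (Q : SlackTab) : SlackTab := fun M₀ z₀ c₀ h =>
  if dist (z₀ h) (z₀ c₀) ≤ R then ρ else ρ + Q M₀ z₀ c₀ h

section ColumnValues

variable {X P Q : SlackTab} {R ρ κ σ : ℝ} {M₀ : ℕ} {z₀ : Fin M₀ → E3} {c₀ h : Fin M₀}

/-- Value of the sum column. [formal bookkeeping] -/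
@[simp] theorem addCol_apply : addCol X P M₀ z₀ c₀ h = X M₀ z₀ c₀ h + P M₀ z₀ c₀ h := rfl

/-- Value of the constant column. [formal bookkeeping] -/
@[simp] theorem constCol_apply : constCol ρ M₀ z₀ c₀ h = ρ := rfl

/-- Inner rows of the rim table. [formal bookkeeping] -/
theorem rimTab_of_le (hd : dist (z₀ h) (z₀ c₀) ≤ R) : rimTab R ρ Q M₀ z₀ c₀ h = ρ := by simp [rimTab, hd]

/-- Rim rows of the rim table. [formal bookkeeping] -/
theorem rimTab_of_lt (hd : R < dist (z₀ h) (z₀ c₀)) : rimTab R ρ Q M₀ z₀ c₀ h = ρ + Q M₀ z₀ c₀ h := by simp [rimTab, not_le.2 hd]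

/-- The rim table dominates its inner value when `Q ≥ 0` at the row. [formal bookkeeping] -/
theorem le_rimTab (hQ : 0 ≤ Q M₀ z₀ c₀ h) : ρ ≤ rimTab R ρ Q M₀ z₀ c₀ h := by
  by_cases hd : dist (z₀ h) (z₀ c₀) ≤ R
  · rw [rimTab_of_le hd]
  · rw [rimTab_of_lt (not_le.1 hd)]; linarith

/-- ★ THE FOLD IS A TABLE: `κ`-inflated slack of the folded column = `κ = 0` slack of the column `X + rimTab R (κσ) Q`. [formal bookkeeping] -/
theorem slack_rimTab_eq : (1 + 0) * σ + addCol X (rimTab R (κ * σ) Q) M₀ z₀ c₀ h = (1 + κ) * σ + foldCol R X Q M₀ z₀ c₀ h := by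
  by_cases hd : dist (z₀ h) (z₀ c₀) ≤ R
  · rw [addCol_apply, rimTab_of_le hd, foldCol_of_le hd]; ring
  · rw [addCol_apply, rimTab_of_lt (not_le.1 hd), foldCol_of_lt (not_le.1 hd)]; ring

end ColumnValues

section Polytopes

variable {κ σ : ℝ} {H : HessTab} {F : ForceTab} {X Y Q : SlackTab} {R : ℝ} {M : ℕ} {z : Fin M → E3} {c : Fin M} {M₀ : ℕ} {z₀ : Fin M₀ → E3} {c₀ : Fin M₀}
  {e : Fin M → Fin M₀}

/-- ★ The `κ`-inflated polytope with column `X` IS the `κ = 0` polytope with column `X + κσ`. [formal bookkeeping] -/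
theorem inForcePolytope_zero_addCol_iff :
    InForcePolytope 0 σ H F (addCol X (constCol (κ * σ))) z c z₀ c₀ e ↔ InForcePolytope κ σ H F X z c z₀ c₀ e := by
  refine forall₃_congr fun a _ _ => ?_
  rw [addCol_apply, constCol_apply, show (1 + 0) * σ + (X M₀ z₀ c₀ (e a) + κ * σ) = (1 + κ) * σ + X M₀ z₀ c₀ (e a) by ring]

/-- ★ The `κ`-inflated FOLDED polytope IS the `κ = 0` polytope with column `X + rimTab R (κσ) Q`. [formal bookkeeping] -/
theorem inForcePolytope_rim_iff :
    InForcePolytope 0 σ H F (addCol X (rimTab R (κ * σ) Q)) z c z₀ c₀ e ↔ InForcePolytope κ σ H F (foldCol R X Q) z c z₀ c₀ e := by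
  refine forall₃_congr fun a _ _ => ?_
  rw [slack_rimTab_eq]

/-- The polytope is MONOTONE in the column. [formal bookkeeping] -/
theorem inForcePolytope_mono_col (hle : ∀ (M₀ : ℕ) (z₀ : Fin M₀ → E3) (c₀ h : Fin M₀), X M₀ z₀ c₀ h ≤ Y M₀ z₀ c₀ h)
    (hP : InForcePolytope κ σ H F X z c z₀ c₀ e) : InForcePolytope κ σ H F Y z c z₀ c₀ e :=
  fun a ha hr => (hP a ha hr).trans (by linarith [hle M₀ z₀ c₀ (e a)])

end Polytopes

/-- `SlackCert` is ANTITONE in the column: a certificate on a larger column serves a smaller one. [formal bookkeeping] -/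
theorem slackCert_anti_col {𝓘 : ChartFam} {τ κ σ : ℝ} {H : HessTab} {F : ForceTab} {X Y : SlackTab}
    (hle : ∀ (M₀ : ℕ) (z₀ : Fin M₀ → E3) (c₀ h : Fin M₀), X M₀ z₀ c₀ h ≤ Y M₀ z₀ c₀ h) (h : SlackCert 𝓘 τ κ σ H F Y) : SlackCert 𝓘 τ κ σ H F X :=
  fun M z c M₀ z₀ c₀ e hz hcl hm hch hP => h M z c M₀ z₀ c₀ e hz hcl hm hch (inForcePolytope_mono_col hle hP)

/-- ★ `SlackCert` at `κ` with column `X` IS `SlackCert` at `0` with column `X + κσ`. [formal bookkeeping] -/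
theorem slackCert_zero_addCol_iff (𝓘 : ChartFam) (τ κ σ : ℝ) (H : HessTab) (F : ForceTab) (X : SlackTab) :
    SlackCert 𝓘 τ 0 σ H F (addCol X (constCol (κ * σ))) ↔ SlackCert 𝓘 τ κ σ H F X := by
  refine forall₄_congr fun M z c M₀ => forall₃_congr fun z₀ c₀ e => forall₄_congr fun _ _ _ _ => ?_
  rw [inForcePolytope_zero_addCol_iff]

/-- ★ `SlackCert` at `κ` on the FOLDED column IS `SlackCert` at `0` with column `X + rimTab R (κσ) Q`. [formal bookkeeping] -/
theorem slackCert_rim_iff (𝓘 : ChartFam) (τ κ σ : ℝ) (H : HessTab) (F : ForceTab) (X Q : SlackTab) (R : ℝ) :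
    SlackCert 𝓘 τ 0 σ H F (addCol X (rimTab R (κ * σ) Q)) ↔ SlackCert 𝓘 τ κ σ H F (foldCol R X Q) := by
  refine forall₄_congr fun M z c M₀ => forall₃_congr fun z₀ c₀ e => forall₄_congr fun _ _ _ _ => ?_
  rw [inForcePolytope_rim_iff]

/-! ## §2. The per-row top and step, the one-stage seam, and the ROW-PRICED DESCENT to the tube floor -/

/-- ★ **`PriceTopTab 𝓘 τ Φ P`** [arithmetic · INSTRUMENTABLE — the per-row a-priori level] — the price of reach row `a` is `≤ P(z₀)(e a)` on every charted
admissible tube state (same binders as `PriceTop`; `PriceTop … ρ` is the constant table). -/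
def PriceTopTab (𝓘 : ChartFam) (τ : ℝ) (Φ : RowPrice) (P : SlackTab) : Prop :=
  ∀ (M : ℕ) (z : Fin M → E3) (c : Fin M) (M₀ : ℕ) (z₀ : Fin M₀ → E3) (c₀ : Fin M₀) (e : Fin M → Fin M₀) (t : ℝ),
    Admissible M z c → CleanBall (63 / 10) z c → MonoPhaseBall (63 / 10) z c → 0 ≤ t → t ≤ constLaw τ M₀ z₀ c₀ → ChartBy 𝓘 τ t z c z₀ c₀ e →
      FineChart τ z c z₀ c₀ e → ∀ a ∈ ball (63 / 10) z c, IsReach z c a → Φ M z c M₀ z₀ c₀ e a ≤ P M₀ z₀ c₀ (e a)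

/-- ★ **`PriceStepTab 𝓘 τ σ Φ H F Y P`** [INSTRUMENTABLE — one constrained sup PER ROW per host cell: `sup {Φ(state, a) : state ∈ tube ∩ P₀(Y)} ≤ P(e a)`] —
on the `κ = 0` polytope with column `Y` (at use `Y = addCol X (P i)`: all slack in the column) the price of reach row `a` is `≤ P(z₀)(e a)`. -/
def PriceStepTab (𝓘 : ChartFam) (τ σ : ℝ) (Φ : RowPrice) (H : HessTab) (F : ForceTab) (Y P : SlackTab) : Prop :=
  ∀ (M : ℕ) (z : Fin M → E3) (c : Fin M) (M₀ : ℕ) (z₀ : Fin M₀ → E3) (c₀ : Fin M₀) (e : Fin M → Fin M₀) (t : ℝ),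
    Admissible M z c → CleanBall (63 / 10) z c → MonoPhaseBall (63 / 10) z c → 0 ≤ t → t ≤ constLaw τ M₀ z₀ c₀ → ChartBy 𝓘 τ t z c z₀ c₀ e →
      FineChart τ z c z₀ c₀ e → InForcePolytope 0 σ H F Y z c z₀ c₀ e →
        ∀ a ∈ ball (63 / 10) z c, IsReach z c a → Φ M z c M₀ z₀ c₀ e a ≤ P M₀ z₀ c₀ (e a)

/-- ★ **THE ONE-STAGE SEAM**: force cap `σ` + priced remainder `≤ Φ + X` + per-row bound `Φ ≤ P` ⟹ `κ = 0` polytope with column `X + P`. [folklore] -/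
theorem inForcePolytope_addCol_of_cap_of_rem {M : ℕ} {z : Fin M → E3} {c : Fin M} {M₀ : ℕ} {z₀ : Fin M₀ → E3} {c₀ : Fin M₀} {e : Fin M → Fin M₀} {σ : ℝ}
    {Φ : RowPrice} {X P : SlackTab} {H : HessTab} {F : ForceTab}
    (hcap : ∀ a ∈ ball (63 / 10) z c, IsReach z c a → ‖siteForce 7 z a‖ ≤ σ)
    (hrem : ∀ a ∈ ball (63 / 10) z c, IsReach z c a → ‖siteForce 7 z a - linForce H F z c z₀ c₀ e a‖ ≤ Φ M z c M₀ z₀ c₀ e a + X M₀ z₀ c₀ (e a))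
    (hP : ∀ a ∈ ball (63 / 10) z c, IsReach z c a → Φ M z c M₀ z₀ c₀ e a ≤ P M₀ z₀ c₀ (e a)) :
    InForcePolytope 0 σ H F (addCol X P) z c z₀ c₀ e := fun a ha hr => by
  have h₂ := norm_lin_le_of_cap_of_rem (σ := σ) (ρ := P M₀ z₀ c₀ (e a)) (x := X M₀ z₀ c₀ (e a)) (hcap a ha hr) (by linarith [hrem a ha hr, hP a ha hr])
  rw [addCol_apply]; linarith

/-- ★★★ **THE ROW-PRICED DESCENT TO THE TUBE FLOOR (R1⁗, cluster level)** — a priced charge `Φ` with column `X`, a per-row a-priori table `P 0`, a FINITE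
sequence of per-row steps `P i ↦ P (i+1)` on the successive `κ = 0` polytopes with columns `addCol X (P i)`, and the first-order certificate on the column
`addCol X (P n)` (census LP with row slack `σ₁ + X(h) + P n (h)`) give (TF).  [folklore: induction on the stage over the tree's `forceCapOne`] -/
theorem tubeFloor_of_pricedCharge_of_tabDescent {𝓘 : ChartFam} {τ : ℝ} {Φ : RowPrice} {X : SlackTab} (P : ℕ → SlackTab) (n : ℕ) (hτ : 0 ≤ τ)
    (hS : PricedCharge 𝓘 τ Φ X) (h0 : PriceTopTab 𝓘 τ Φ (P 0))
    (hs : ∀ i : ℕ, i < n → PriceStepTab 𝓘 τ sigmaOne Φ hessBlk0 force0 (addCol X (P i)) (P (i + 1)))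
    (hC : SlackCert 𝓘 τ 0 sigmaOne hessBlk0 force0 (addCol X (P n))) : TubeFloor 𝓘 τ := by
  intro M z c M₀ z₀ c₀ e hz hcl hm hch
  have hf : FineChart τ z c z₀ c₀ e := fineChart_of_chartBy hch
  have hcap : ∀ a ∈ ball (63 / 10) z c, IsReach z c a → ‖siteForce 7 z a‖ ≤ sigmaOne := fun a _ hr => forceCapOne M z c hz a hr
  have hrem : ∀ a ∈ ball (63 / 10) z c, IsReach z c a →
      ‖siteForce 7 z a - linForce hessBlk0 force0 z c z₀ c₀ e a‖ ≤ Φ M z c M₀ z₀ c₀ e a + X M₀ z₀ c₀ (e a) :=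
    fun a ha hr => hS M z c M₀ z₀ c₀ e τ hz hcl hm hτ le_rfl hch hf a ha hr
  have key : ∀ i : ℕ, i ≤ n → InForcePolytope 0 sigmaOne hessBlk0 force0 (addCol X (P i)) z c z₀ c₀ e := by
    intro i
    induction i with
    | zero => exact fun _ => inForcePolytope_addCol_of_cap_of_rem hcap hrem fun a ha hr => h0 M z c M₀ z₀ c₀ e τ hz hcl hm hτ le_rfl hch hf a ha hr
    | succ i ih =>
        exact fun hi => inForcePolytope_addCol_of_cap_of_rem hcap hrem fun a ha hr =>
          hs i (Nat.lt_of_succ_le hi) M z c M₀ z₀ c₀ e τ hz hcl hm hτ le_rfl hch hf (ih (Nat.le_of_succ_le hi)) a ha hr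
  exact hC M z c M₀ z₀ c₀ e hz hcl hm hch (key n le_rfl)

/-- ★★ **[CORE-FAR] FROM THE ROW-PRICED DESCENT AT ANY DIAL `(𝓘, τ)`** (tree `coreOff_of_tubeFloor_of_cover_eighth`). [formal bookkeeping] -/
theorem coreOff_of_tabDescent {𝓘 : ChartFam} {τ : ℝ} {Φ : RowPrice} {X : SlackTab} (P : ℕ → SlackTab) (n : ℕ) (hτ : 0 ≤ τ)
    (hS : PricedCharge 𝓘 τ Φ X) (h0 : PriceTopTab 𝓘 τ Φ (P 0))
    (hs : ∀ i : ℕ, i < n → PriceStepTab 𝓘 τ sigmaOne Φ hessBlk0 force0 (addCol X (P i)) (P (i + 1)))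
    (hC : SlackCert 𝓘 τ 0 sigmaOne hessBlk0 force0 (addCol X (P n))) (hcov : FamilyCover 𝓘 (24 / 5) (1 / 100) (1 / 8) τ) :
    CoreOffTubeFloor (63 / 10) (63 / 10) (24 / 5) (1 / 100) 0 :=
  coreOff_of_tubeFloor_of_cover_eighth (tubeFloor_of_pricedCharge_of_tabDescent P n hτ hS h0 hs hC) hcov

/-- The per-row step is MONOTONE in the target table and ANTITONE in the column. [formal bookkeeping] -/
theorem PriceStepTab.mono {𝓘 : ChartFam} {τ σ : ℝ} {Φ : RowPrice} {H : HessTab} {F : ForceTab} {Y Y' P P' : SlackTab}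
    (hY : ∀ (M₀ : ℕ) (z₀ : Fin M₀ → E3) (c₀ h : Fin M₀), Y' M₀ z₀ c₀ h ≤ Y M₀ z₀ c₀ h)
    (hPP : ∀ (M₀ : ℕ) (z₀ : Fin M₀ → E3) (c₀ h : Fin M₀), P M₀ z₀ c₀ h ≤ P' M₀ z₀ c₀ h) (h : PriceStepTab 𝓘 τ σ Φ H F Y P) :
    PriceStepTab 𝓘 τ σ Φ H F Y' P' :=
  fun M z c M₀ z₀ c₀ e t hz hcl hm ht htT hch hf hP a ha hr =>
    (h M z c M₀ z₀ c₀ e t hz hcl hm ht htT hch hf (inForcePolytope_mono_col hY hP) a ha hr).trans (hPP M₀ z₀ c₀ (e a))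

/-- A per-row top is a per-row step on every column (the polytope hypothesis unused). [formal bookkeeping] -/
theorem priceStepTab_of_priceTopTab {𝓘 : ChartFam} {τ : ℝ} {Φ : RowPrice} {P : SlackTab} (σ : ℝ) (H : HessTab) (F : ForceTab) (Y : SlackTab)
    (h : PriceTopTab 𝓘 τ Φ P) : PriceStepTab 𝓘 τ σ Φ H F Y P :=
  fun M z c M₀ z₀ c₀ e t hz hcl hm ht htT hch hf _ => h M z c M₀ z₀ c₀ e t hz hcl hm ht htT hch hf

/-- (TOP ρ) is the per-row top with the constant table. [formal bookkeeping] -/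
theorem priceTopTab_of_priceTop {𝓘 : ChartFam} {τ ρ : ℝ} {Φ : RowPrice} (h : PriceTop 𝓘 τ Φ ρ) : PriceTopTab 𝓘 τ Φ (constCol ρ) :=
  fun M z c M₀ z₀ c₀ e t hz hcl hm ht htT hch hf a ha hr => h M z c M₀ z₀ c₀ e t hz hcl hm ht htT hch hf a ha hr

/-- (STEP κ ρ) on column `X` is the per-row step on the column `X + κσ` with the constant table `ρ`. [formal bookkeeping] -/
theorem priceStepTab_of_priceStep {𝓘 : ChartFam} {τ σ κ ρ : ℝ} {Φ : RowPrice} {H : HessTab} {F : ForceTab} {X : SlackTab}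
    (h : PriceStep 𝓘 τ σ Φ H F X κ ρ) : PriceStepTab 𝓘 τ σ Φ H F (addCol X (constCol (κ * σ))) (constCol ρ) :=
  fun M z c M₀ z₀ c₀ e t hz hcl hm ht htT hch hf hP a ha hr =>
    h M z c M₀ z₀ c₀ e t hz hcl hm ht htT hch hf (inForcePolytope_zero_addCol_iff.1 hP) a ha hr

/-- ★ (TOP-in R ρ) and (RIMTOP R Q), `ρ ≥ 0`, give the per-row top with the RIM TABLE `rimTab R ρ Q`. [formal bookkeeping] -/
theorem priceTopTab_rim {𝓘 : ChartFam} {τ R ρ : ℝ} {Φ : RowPrice} {Q : SlackTab} (hρ : 0 ≤ ρ) (hT : PriceTopIn 𝓘 τ Φ R ρ) (hQ : RimTop 𝓘 τ Φ R Q) :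
    PriceTopTab 𝓘 τ Φ (rimTab R ρ Q) := by
  intro M z c M₀ z₀ c₀ e t hz hcl hm ht htT hch hf a ha hr
  by_cases hd : dist (z₀ (e a)) (z₀ c₀) ≤ R
  · rw [rimTab_of_le hd]
    exact hT M z c M₀ z₀ c₀ e t hz hcl hm ht htT hch hf a ha hr hd
  · rw [rimTab_of_lt (not_le.1 hd)]
    linarith [hQ M z c M₀ z₀ c₀ e t hz hcl hm ht htT hch hf a ha hr (not_le.1 hd)]

/-- ★ (STEP-in κ R ρ) on the FOLDED column and (RIMTOP R Q), `ρ ≥ 0`, give the per-row step on `X + rimTab R (κσ) Q` with target `rimTab R ρ Q`. -/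
theorem priceStepTab_rim {𝓘 : ChartFam} {τ σ κ R ρ : ℝ} {Φ : RowPrice} {H : HessTab} {F : ForceTab} {X Q : SlackTab} (hρ : 0 ≤ ρ)
    (hs : PriceStepIn 𝓘 τ σ Φ H F (foldCol R X Q) κ R ρ) (hQ : RimTop 𝓘 τ Φ R Q) :
    PriceStepTab 𝓘 τ σ Φ H F (addCol X (rimTab R (κ * σ) Q)) (rimTab R ρ Q) := by
  intro M z c M₀ z₀ c₀ e t hz hcl hm ht htT hch hf hP a ha hr
  by_cases hd : dist (z₀ (e a)) (z₀ c₀) ≤ R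
  · rw [rimTab_of_le hd]
    exact hs M z c M₀ z₀ c₀ e t hz hcl hm ht htT hch hf (inForcePolytope_rim_iff.1 hP) a ha hr hd
  · rw [rimTab_of_lt (not_le.1 hd)]
    linarith [hQ M z c M₀ z₀ c₀ e t hz hcl hm ht htT hch hf a ha hr (not_le.1 hd)]

/-- ★ (R2) RECOVERY OF g71's UNIFORM DESCENT as the constant-table instance of the row-priced descent. [formal bookkeeping] -/
theorem tubeFloor_of_descent_via_tab {𝓘 : ChartFam} {τ : ℝ} {Φ : RowPrice} {X : SlackTab} (k : ℕ → ℝ) (n : ℕ) (hτ : 0 ≤ τ)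
    (hS : PricedCharge 𝓘 τ Φ X) (h0 : PriceTop 𝓘 τ Φ (k 0 * sigmaOne))
    (hs : ∀ i : ℕ, i < n → PriceStep 𝓘 τ sigmaOne Φ hessBlk0 force0 X (k i) (k (i + 1) * sigmaOne))
    (hC : SlackCert 𝓘 τ (k n) sigmaOne hessBlk0 force0 X) : TubeFloor 𝓘 τ :=
  tubeFloor_of_pricedCharge_of_tabDescent (fun i => constCol (k i * sigmaOne)) n hτ hS (priceTopTab_of_priceTop h0)
    (fun i hi => priceStepTab_of_priceStep (hs i hi)) ((slackCert_zero_addCol_iff 𝓘 τ (k n) sigmaOne hessBlk0 force0 X).2 hC)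

/-- ★ (R2) RECOVERY OF g74's FOLDED DESCENT as the rim-table instance (no `foldPrice` needed: the rim rows' target is `k·σ₁ + Q`). [formal bookkeeping] -/
theorem tubeFloor_of_foldedDescent_via_tab {𝓘 : ChartFam} {τ R : ℝ} {Φ : RowPrice} {X Q : SlackTab} (k : ℕ → ℝ) (n : ℕ) (hτ : 0 ≤ τ)
    (hk : ∀ i : ℕ, 0 ≤ k i) (hS : PricedCharge 𝓘 τ Φ X) (hQ : RimTop 𝓘 τ Φ R Q) (h0 : PriceTopIn 𝓘 τ Φ R (k 0 * sigmaOne))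
    (hs : ∀ i : ℕ, i < n → PriceStepIn 𝓘 τ sigmaOne Φ hessBlk0 force0 (foldCol R X Q) (k i) R (k (i + 1) * sigmaOne))
    (hC : SlackCert 𝓘 τ (k n) sigmaOne hessBlk0 force0 (foldCol R X Q)) : TubeFloor 𝓘 τ :=
  tubeFloor_of_pricedCharge_of_tabDescent (fun i => rimTab R (k i * sigmaOne) Q) n hτ hS (priceTopTab_rim (mul_nonneg (hk 0) sigmaOne_pos.le) h0 hQ)
    (fun i hi => priceStepTab_rim (mul_nonneg (hk (i + 1)) sigmaOne_pos.le) (hs i hi) hQ)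
    ((slackCert_rim_iff 𝓘 τ (k n) sigmaOne hessBlk0 force0 X Q R).2 hC)

/-! ## §3. The HOST formats with per-row tables (what the census emits) and their soundness -/

/-- ★ **(HTOP-tab) `HostTopTab 𝓘 τ B T r P`** [INSTRUMENTABLE · finite-dimensional per host — the per-row START table]: on every instance, every admissible
host reading and every maybe-reach row `h`, the host quadratic price is `≤ P(z₀)(h)`. -/
def HostTopTab (𝓘 : ChartFam) (τ : ℝ) (B : E3 → E3 →L[ℝ] E3 →L[ℝ] E3) (T : ℝ → ℝ → ℝ) (r : ℝ) (P : SlackTab) : Prop :=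
  ∀ (M₀ : ℕ) (z₀ : Fin M₀ → E3) (c₀ : Fin M₀), 𝓘 M₀ z₀ c₀ → ∀ (O : Finset (Fin M₀)) (D : Fin M₀ → E3), HostReading τ z₀ c₀ O D →
    ∀ h ∈ O, HostMaybeReach τ z₀ c₀ O h → hostQuad B T r z₀ O D h ≤ P M₀ z₀ c₀ h

/-- ★ **(HSTEP-tab) `HostStepTab 𝓘 τ σ B T r H F Y P`** [INSTRUMENTABLE · finite-dimensional per host — ONE constrained sup PER ROW per host cell and
occupancy]: on every instance, every admissible host reading whose linear rows at the SURE-reach rows satisfy `‖hostLin‖ ≤ σ + Y(h)` (at use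
`Y = addCol X (P i)`), the host quadratic price of every MAYBE-reach row `h` is `≤ P(z₀)(h)`. -/
def HostStepTab (𝓘 : ChartFam) (τ σ : ℝ) (B : E3 → E3 →L[ℝ] E3 →L[ℝ] E3) (T : ℝ → ℝ → ℝ) (r : ℝ) (H : HessTab) (F : ForceTab) (Y P : SlackTab) : Prop :=
  ∀ (M₀ : ℕ) (z₀ : Fin M₀ → E3) (c₀ : Fin M₀), 𝓘 M₀ z₀ c₀ → ∀ (O : Finset (Fin M₀)) (D : Fin M₀ → E3), HostReading τ z₀ c₀ O D →
    (∀ h ∈ O, HostSureReach τ z₀ c₀ O h → ‖hostLin H F z₀ c₀ O D h‖ ≤ σ + Y M₀ z₀ c₀ h) →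
      ∀ h ∈ O, HostMaybeReach τ z₀ c₀ O h → hostQuad B T r z₀ O D h ≤ P M₀ z₀ c₀ h

/-- A per-row host top is a per-row host step on every column. [formal bookkeeping] -/
theorem hostStepTab_of_hostTopTab {𝓘 : ChartFam} {τ : ℝ} {B : E3 → E3 →L[ℝ] E3 →L[ℝ] E3} {T : ℝ → ℝ → ℝ} {r : ℝ} {P : SlackTab}
    (h : HostTopTab 𝓘 τ B T r P) (σ : ℝ) (H : HessTab) (F : ForceTab) (Y : SlackTab) : HostStepTab 𝓘 τ σ B T r H F Y P :=
  fun M₀ z₀ c₀ hI O D hR _ => h M₀ z₀ c₀ hI O D hR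

/-- The per-row host step is MONOTONE in the target table and ANTITONE in the column. [formal bookkeeping] -/
theorem HostStepTab.mono {𝓘 : ChartFam} {τ σ : ℝ} {B : E3 → E3 →L[ℝ] E3 →L[ℝ] E3} {T : ℝ → ℝ → ℝ} {r : ℝ} {H : HessTab} {F : ForceTab}
    {Y Y' P P' : SlackTab} (hY : ∀ (M₀ : ℕ) (z₀ : Fin M₀ → E3) (c₀ h : Fin M₀), Y' M₀ z₀ c₀ h ≤ Y M₀ z₀ c₀ h)
    (hPP : ∀ (M₀ : ℕ) (z₀ : Fin M₀ → E3) (c₀ h : Fin M₀), P M₀ z₀ c₀ h ≤ P' M₀ z₀ c₀ h) (h : HostStepTab 𝓘 τ σ B T r H F Y P) :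
    HostStepTab 𝓘 τ σ B T r H F Y' P' :=
  fun M₀ z₀ c₀ hI O D hR hL h' hh hm =>
    (h M₀ z₀ c₀ hI O D hR (fun h'' hh'' hs => (hL h'' hh'' hs).trans (by linarith [hY M₀ z₀ c₀ h''])) h' hh hm).trans (hPP M₀ z₀ c₀ h')

/-- (HTOP ρ) is the per-row host top with the constant table. [formal bookkeeping] -/
theorem hostTopTab_of_hostTop {𝓘 : ChartFam} {τ : ℝ} {B : E3 → E3 →L[ℝ] E3 →L[ℝ] E3} {T : ℝ → ℝ → ℝ} {r ρ : ℝ} (h : HostTop 𝓘 τ B T r ρ) :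
    HostTopTab 𝓘 τ B T r (constCol ρ) :=
  fun M₀ z₀ c₀ hI O D hR h' hh hm => h M₀ z₀ c₀ hI O D hR h' hh hm

/-- (HSTEP κ ρ) on column `X` is the per-row host step on the column `X + κσ` with the constant table `ρ`. [formal bookkeeping] -/
theorem hostStepTab_of_hostStep {𝓘 : ChartFam} {τ σ : ℝ} {B : E3 → E3 →L[ℝ] E3 →L[ℝ] E3} {T : ℝ → ℝ → ℝ} {r : ℝ} {H : HessTab} {F : ForceTab} {X : SlackTab}
    {κ ρ : ℝ} (h : HostStep 𝓘 τ σ B T r H F X κ ρ) : HostStepTab 𝓘 τ σ B T r H F (addCol X (constCol (κ * σ))) (constCol ρ) :=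
  fun M₀ z₀ c₀ hI O D hR hL h' hh hm =>
    h M₀ z₀ c₀ hI O D hR (fun h'' hh'' hs => by have h₁ := hL h'' hh'' hs; rw [addCol_apply, constCol_apply] at h₁; linarith) h' hh hm

/-- ★ (HTOP-in R ρ) and (HRIM R Q), `ρ ≥ 0`, give the per-row host top with the rim table. [formal bookkeeping] -/
theorem hostTopTab_rim {𝓘 : ChartFam} {τ : ℝ} {B : E3 → E3 →L[ℝ] E3 →L[ℝ] E3} {T : ℝ → ℝ → ℝ} {r R ρ : ℝ} {Q : SlackTab} (hρ : 0 ≤ ρ)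
    (hT : HostTopIn 𝓘 τ B T r R ρ) (hQ : HostRimTop 𝓘 τ B T r R Q) : HostTopTab 𝓘 τ B T r (rimTab R ρ Q) := by
  intro M₀ z₀ c₀ hI O D hR h hh hm
  by_cases hd : dist (z₀ h) (z₀ c₀) ≤ R
  · rw [rimTab_of_le hd]
    exact hT M₀ z₀ c₀ hI O D hR h hh hm hd
  · rw [rimTab_of_lt (not_le.1 hd)]
    linarith [hQ M₀ z₀ c₀ hI O D hR h hh hm (not_le.1 hd)]

/-- ★ (HSTEP-in κ R ρ) on the FOLDED column and (HRIM R Q), `ρ ≥ 0`, give the per-row host step on `X + rimTab R (κσ) Q` with target `rimTab R ρ Q`. -/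
theorem hostStepTab_rim {𝓘 : ChartFam} {τ σ : ℝ} {B : E3 → E3 →L[ℝ] E3 →L[ℝ] E3} {T : ℝ → ℝ → ℝ} {r : ℝ} {H : HessTab} {F : ForceTab} {X Q : SlackTab}
    {κ R ρ : ℝ} (hρ : 0 ≤ ρ) (hs : HostStepIn 𝓘 τ σ B T r H F (foldCol R X Q) κ R ρ) (hQ : HostRimTop 𝓘 τ B T r R Q) :
    HostStepTab 𝓘 τ σ B T r H F (addCol X (rimTab R (κ * σ) Q)) (rimTab R ρ Q) := by
  intro M₀ z₀ c₀ hI O D hR hL h hh hm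
  have hL' : ∀ h' ∈ O, HostSureReach τ z₀ c₀ O h' → ‖hostLin H F z₀ c₀ O D h'‖ ≤ (1 + κ) * σ + foldCol R X Q M₀ z₀ c₀ h' := fun h' hh' hs' => by
    linarith [hL h' hh' hs', @slack_rimTab_eq X Q R κ σ M₀ z₀ c₀ h']
  by_cases hd : dist (z₀ h) (z₀ c₀) ≤ R
  · rw [rimTab_of_le hd]
    exact hs M₀ z₀ c₀ hI O D hR hL' h hh hm hd
  · rw [rimTab_of_lt (not_le.1 hd)]
    linarith [hQ M₀ z₀ c₀ hI O D hR h hh hm (not_le.1 hd)]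

/-- ★★ **`priceTopTab_of_hostTopTab`** — (HTOP-tab P) ⟹ `PriceTopTab 𝓘 τ (quadPrice B T r) P`. [formal bookkeeping over g73 part 2's host reading] -/
theorem priceTopTab_of_hostTopTab {𝓘 : ChartFam} {τ : ℝ} {B : E3 → E3 →L[ℝ] E3 →L[ℝ] E3} {T : ℝ → ℝ → ℝ} {r : ℝ} {P : SlackTab}
    (hH : HostTopTab 𝓘 τ B T r P) : PriceTopTab 𝓘 τ (quadPrice B T r) P := by
  intro M z c M₀ z₀ c₀ e t hz hcl hm ht htT hch hf a ha hr
  have hinj : ∀ b b', b ∈ ball (63 / 10) z c → b' ∈ ball (63 / 10) z c → e b = e b' → b = b' := fun b b' hb hb' hE =>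
    hch.2.2.2.2.1 b b' (mem_ball.1 hb) (mem_ball.1 hb') hE
  rw [quadPrice_eq_hostQuad B T r hinj ha]
  exact hH M₀ z₀ c₀ hch.1 _ _ (hostReading_of_chart hch hf) (e a) (mem_occ_of_mem ha) (hostMaybeReach_of_isReach hf ha hr)

/-- ★★★ **`priceStepTab_of_hostStepTab`** — (HSTEP-tab Y P) ⟹ `PriceStepTab 𝓘 τ σ (quadPrice B T r) H F Y P` (polytope rows ↦ SURE-reach host rows
with slack `σ + Y`; conclusion back from the MAYBE-reach rows). [formal bookkeeping over g73 part 2's host reading] -/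
theorem priceStepTab_of_hostStepTab {𝓘 : ChartFam} {τ σ : ℝ} {B : E3 → E3 →L[ℝ] E3 →L[ℝ] E3} {T : ℝ → ℝ → ℝ} {r : ℝ} {H : HessTab} {F : ForceTab}
    {Y P : SlackTab} (hH : HostStepTab 𝓘 τ σ B T r H F Y P) : PriceStepTab 𝓘 τ σ (quadPrice B T r) H F Y P := by
  intro M z c M₀ z₀ c₀ e t hz hcl hm ht htT hch hf hP a ha hr
  have hinj : ∀ b b', b ∈ ball (63 / 10) z c → b' ∈ ball (63 / 10) z c → e b = e b' → b = b' := fun b b' hb hb' hE =>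
    hch.2.2.2.2.1 b b' (mem_ball.1 hb) (mem_ball.1 hb') hE
  rw [quadPrice_eq_hostQuad B T r hinj ha]
  refine hH M₀ z₀ c₀ hch.1 _ _ (hostReading_of_chart hch hf) (fun h hh hs => ?_) (e a) (mem_occ_of_mem ha) (hostMaybeReach_of_isReach hf ha hr)
  obtain ⟨a', ha', rfl, hr'⟩ := isReach_of_hostSureReach hf hh hs
  rw [← linForce_eq_hostLin H F hinj a']
  have h₁ := hP a' ha' hr'
  linarith

/-! ## §4. The T-leaf records with per-row tables -/

/-- ★★★ **THE T-LEAF RECORD WITH PER-ROW HOST TABLES** (general bond data): cover, (C2L) at `m = 2τ`, host separation, far column, START table `P 0`,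
per-row host steps `P i ↦ P (i+1)` on the columns `addCol X (P i)`, terminal certificate on `addCol X (P n)`. [formal bookkeeping: `coreOff_of_tabDescent` + §3] -/
theorem coreOff_of_hostTabs {𝓘 : ChartFam} {τ s₀ r : ℝ} {B : E3 → E3 →L[ℝ] E3 →L[ℝ] E3} {L : ℝ → ℝ} {X : SlackTab} (P : ℕ → SlackTab) (n : ℕ) (hτ : 0 ≤ τ)
    (hcov : FamilyCover 𝓘 (24 / 5) (1 / 100) (1 / 8) τ) (hC : BondHessLip B L s₀ r (2 * τ)) (hsep : HostSep 𝓘 s₀) (hX : FarColumn 𝓘 τ r X)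
    (h0 : HostTopTab 𝓘 τ B (cubicTail L) r (P 0))
    (hs : ∀ i : ℕ, i < n → HostStepTab 𝓘 τ sigmaOne B (cubicTail L) r hessBlk0 force0 (addCol X (P i)) (P (i + 1)))
    (hcert : SlackCert 𝓘 τ 0 sigmaOne hessBlk0 force0 (addCol X (P n))) : CoreOffTubeFloor (63 / 10) (63 / 10) (24 / 5) (1 / 100) 0 :=
  coreOff_of_tabDescent P n hτ (pricedCharge_quadPrice_of_bondHessLip hC hsep hX) (priceTopTab_of_hostTopTab h0)
    (fun i hi => priceStepTab_of_hostStepTab (hs i hi)) hcert hcov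

/-- ★★★ **THE T-LEAF RECORD R1⁗: ROW-PRICED, ALL TABLES CLOSED-FORM OR PER-HOST** — `[CORE-FAR]` from: the cover, `2τ < s₀`, host separation, `r + 2τ ≤ 7`,
(HFAR), the per-host-row tail certificate (TAILCERT), a dominating column `X ≥ Xh + Xe`, the per-row host START table `P 0` and a finite sequence of per-row
host steps with the γ-envelope tail `cubicTail (s ↦ gammaMaj (s − 2τ))` on the columns `addCol X (P i)`, and the terminal certificate on the column
`addCol X (P n)` (census LP with row slack `σ₁ + X(h) + P n (h)`).  [formal bookkeeping: `coreOff_of_hostTabs` + parts 3–5 of the landed tail packing] -/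
theorem coreOff_of_envelope_tailCert_tab {𝓘 : ChartFam} {τ s₀ r : ℝ} {X Xh Xe : SlackTab} (P : ℕ → SlackTab) (n : ℕ) (hτ : 0 ≤ τ)
    (hcov : FamilyCover 𝓘 (24 / 5) (1 / 100) (1 / 8) τ) (hτs : 2 * τ < s₀) (hsep : HostSep 𝓘 s₀) (hr7 : r + 2 * τ ≤ 7)
    (hH : HostFarTab 𝓘 τ r Xh) (hT : TailCert 𝓘 τ Xe) (hdom : ∀ (M₀ : ℕ) (z₀ : Fin M₀ → E3) (c₀ h : Fin M₀), Xh M₀ z₀ c₀ h + Xe M₀ z₀ c₀ h ≤ X M₀ z₀ c₀ h)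
    (h0 : HostTopTab 𝓘 τ bondD3 (cubicTail fun s => gammaMaj (s - 2 * τ)) r (P 0))
    (hs : ∀ i : ℕ, i < n → HostStepTab 𝓘 τ sigmaOne bondD3 (cubicTail fun s => gammaMaj (s - 2 * τ)) r hessBlk0 force0 (addCol X (P i)) (P (i + 1)))
    (hcert : SlackCert 𝓘 τ 0 sigmaOne hessBlk0 force0 (addCol X (P n))) : CoreOffTubeFloor (63 / 10) (63 / 10) (24 / 5) (1 / 100) 0 :=
  coreOff_of_hostTabs P n hτ hcov (bondHessLip_env hτs) hsep (farColumn_mono hdom (farColumn_of_hostFarTab hr7 hτ hH (extTail_of_tailCert hT))) h0 hs hcert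

/-- ★★★ The same record with a census γ-table `L` instead of the envelope. [formal bookkeeping] -/
theorem coreOff_of_gammaTable_tailCert_tab {𝓘 : ChartFam} {τ s₀ r : ℝ} {L : ℝ → ℝ} {X Xh Xe : SlackTab} (P : ℕ → SlackTab) (n : ℕ) (hτ : 0 ≤ τ)
    (hcov : FamilyCover 𝓘 (24 / 5) (1 / 100) (1 / 8) τ) (hτs : 2 * τ < s₀)
    (hL : ∀ s : ℝ, s₀ ≤ s → s < r → ∀ s' : ℝ, |s' - s| ≤ 2 * τ → bondGamma s' ≤ L s) (hsep : HostSep 𝓘 s₀) (hr7 : r + 2 * τ ≤ 7)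
    (hH : HostFarTab 𝓘 τ r Xh) (hT : TailCert 𝓘 τ Xe) (hdom : ∀ (M₀ : ℕ) (z₀ : Fin M₀ → E3) (c₀ h : Fin M₀), Xh M₀ z₀ c₀ h + Xe M₀ z₀ c₀ h ≤ X M₀ z₀ c₀ h)
    (h0 : HostTopTab 𝓘 τ bondD3 (cubicTail L) r (P 0))
    (hs : ∀ i : ℕ, i < n → HostStepTab 𝓘 τ sigmaOne bondD3 (cubicTail L) r hessBlk0 force0 (addCol X (P i)) (P (i + 1)))
    (hcert : SlackCert 𝓘 τ 0 sigmaOne hessBlk0 force0 (addCol X (P n))) : CoreOffTubeFloor (63 / 10) (63 / 10) (24 / 5) (1 / 100) 0 :=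
  coreOff_of_hostTabs P n hτ hcov (bondHessLip_of_gammaTable hτs hL) hsep (farColumn_mono hdom (farColumn_of_hostFarTab hr7 hτ hH (extTail_of_tailCert hT)))
    h0 hs hcert

/-- ★ (R2) RECOVERY OF R1‴ (`…RimFold.coreOff_of_envelope_tailCert_fold`) FROM R1⁗ with the rim tables `rimTab R (k i · σ₁) Q`. [formal bookkeeping] -/
theorem coreOff_of_envelope_tailCert_fold_via_tab {𝓘 : ChartFam} {τ s₀ r R : ℝ} {X Xh Xe Q : SlackTab} (k : ℕ → ℝ) (n : ℕ) (hτ : 0 ≤ τ)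
    (hk : ∀ i : ℕ, 0 ≤ k i) (hcov : FamilyCover 𝓘 (24 / 5) (1 / 100) (1 / 8) τ) (hτs : 2 * τ < s₀) (hsep : HostSep 𝓘 s₀) (hr7 : r + 2 * τ ≤ 7)
    (hH : HostFarTab 𝓘 τ r Xh) (hT : TailCert 𝓘 τ Xe) (hdom : ∀ (M₀ : ℕ) (z₀ : Fin M₀ → E3) (c₀ h : Fin M₀), Xh M₀ z₀ c₀ h + Xe M₀ z₀ c₀ h ≤ X M₀ z₀ c₀ h)
    (hQ : HostRimTop 𝓘 τ bondD3 (cubicTail fun s => gammaMaj (s - 2 * τ)) r R Q)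
    (h0 : HostTopIn 𝓘 τ bondD3 (cubicTail fun s => gammaMaj (s - 2 * τ)) r R (k 0 * sigmaOne))
    (hs : ∀ i : ℕ, i < n → HostStepIn 𝓘 τ sigmaOne bondD3 (cubicTail fun s => gammaMaj (s - 2 * τ)) r hessBlk0 force0 (foldCol R X Q) (k i) R (k (i + 1) * sigmaOne))
    (hcert : SlackCert 𝓘 τ (k n) sigmaOne hessBlk0 force0 (foldCol R X Q)) : CoreOffTubeFloor (63 / 10) (63 / 10) (24 / 5) (1 / 100) 0 :=
  coreOff_of_envelope_tailCert_tab (fun i => rimTab R (k i * sigmaOne) Q) n hτ hcov hτs hsep hr7 hH hT hdom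
    (hostTopTab_rim (mul_nonneg (hk 0) sigmaOne_pos.le) h0 hQ) (fun i hi => hostStepTab_rim (mul_nonneg (hk (i + 1)) sigmaOne_pos.le) (hs i hi) hQ)
    ((slackCert_rim_iff 𝓘 τ (k n) sigmaOne hessBlk0 force0 X Q R).2 hcert)

end Summit.AtomisticToContinuum.Crystallization.Theorems.FrustratedLawDichotomyStrainedPatchRowPrice
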